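import Literature.Computability.Cryptography.LWERegevTransforms
import Literature.Computability.Cryptography.LWEProofs
import Literature.Computability.Cryptography.LeftoverHashUniversal
import HarnessLib

/-!
# LWE with an arbitrary secret law, binary-secret LWE, and the random self-reduction to a uniform secret (BLPRS 2013, Def. 2.11)

Topic `Computability/Cryptography` (LWE), grouping namespace `LWE` (the model of
`Literature/Computability/Cryptography/LWE.lean`). Proved material (no named fact is introduced)
towards the named fact `Literature.Computability.Cryptography.blprs_gapSVP_sqrt_dim_to_lwe_classical`
(**pqc.S21**; Brakerski–Langlois–Peikert–Regev–Stehlé, STOC 2013, Thm. 1.1), namely the secret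
distributions of its §2.3 and the glue reduction named in hypothesis `h₃` of
`BLPRSReduction.lean` ("the standard random self-reduction from `{0,1}`-secrets to uniform secrets,
Def. 2.11"):

> **Definition 2.11.** For integers `n, q ≥ 1`, an error distribution `φ` over `ℝ`, and a distribution
> `𝒟` over `ℤⁿ`, the (average-case) decision variant of the LWE problem, denoted `LWE_{n,q,φ}(𝒟)`, is
> to distinguish given arbitrarily many independent samples, the uniform distribution over `𝕋_qⁿ × 𝕋`
> from `A_{q,s,φ}` for a fixed `s` sampled from `𝒟`. The variant where the algorithm only gets a
> bounded number of samples `m ∈ ℕ` is denoted `LWE_{n,m,q,φ}(𝒟)`. … using a standard random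
> self-reduction, for any distribution over secrets `𝒟`, one can reduce `LWE_{n,q,φ}(𝒟)` to
> `LWE_{n,q,φ}(U({0, …, q-1}ⁿ))` … Since the case when `𝒟` is uniform over `{0,1}ⁿ` plays an
> important role in this paper, we will denote it by `binLWE_{n,q,φ}` (and by `binLWE_{n,m,q,φ}` …).

In the tree's discrete model over a finite commutative ring `R` (`ℤ_q` for BLPRS), with `m` samples:

* `lweSamplesSecretLaw χ σ m` — `LWE_{m,χ}(σ)`: `s ← σ`, then `A_{s,χ}^m`; more generally
  `lweSamplesSecretNoiseLaw χ σ m` with a noise law `χ s` allowed to depend on the secret (the shape of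
  the "unknown noise `β(s) ≤ α`" variant, Def. 2.14); `advantageSecretLaw`, `advantageSecretNoiseLaw`
  (advantage against the uniform samples `U^m`, as `distinguishingAdvantage`);
  `lweSamplesSecretLaw_uniform` / `advantageSecretLaw_uniform` — the uniform secret law gives back the
  tree's `lweSamplesUniformSecret` / `distinguishingAdvantage` (definitionally);
* `binarySecretLaw n q` (uniform on `{0,1}ⁿ ⊆ ℤ_qⁿ`, the filtered `Finset.univ` of
  `LeftoverHashUniversal.lean`), `binLWESamples χ m`, `binLWEAdvantage χ m D` — `binLWE_{n,m,q,χ}`;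
* **the random self-reduction** `secretShift m` (fresh uniform `t`, every sample
  `(a, b) ↦ (a, b + ⟨a, t⟩)`, the map `f_t` of Regev 2009, Lemma 4.1 = the tree's `shiftSample`):
  `lweSamples_bind_secretShift` (`A_{s,χ}^m ↦ A_{U,χ}^m` for EVERY `s`),
  `lweSamplesSecretNoiseLaw_bind_secretShift` (secret law `σ`, secret-dependent noise: the new secret is
  uniform and independent of the hidden `s ← σ` selecting the noise law), `uniformSamples_bind_secretShift`
  (`U^m ↦ U^m`), and the advantage identities **`advantageSecretLaw_secretShift`**
  (`Adv_{LWE(σ)}(D ∘ shift) = Adv_{LWE(U)}(D)`: "`LWE(𝒟) ≤ LWE(U)`" with no loss, any `σ`) and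
  **`binLWEAdvantage_secretShift`** (the case `σ = U({0,1}ⁿ)`).

## References

* Z. Brakerski, A. Langlois, C. Peikert, O. Regev, D. Stehlé, *Classical hardness of learning with
  errors*, STOC 2013; arXiv:1306.0281, §2.3, Def. 2.11 (and the remark following it), Def. 2.14.
* O. Regev, *On lattices, learning with errors, random linear codes, and cryptography*, J. ACM 56
  (2009), §4, proof of Lemma 4.1 (the shift `(a, b) ↦ (a, b + ⟨a, t⟩)`).
-/

noncomputable section

open scoped ENNReal

namespace Literature.Computability.Cryptography

namespace LWE

/-! ### LWE with an arbitrary secret law (Def. 2.11) -/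

section SecretLaw

variable {ι : Type} [Fintype ι] [DecidableEq ι] {R : Type} [CommRing R] [Fintype R]

/-- `LWE_{m,χ}(σ)` (BLPRS Def. 2.11, bounded number of samples): a secret `s ← σ` for an arbitrary law
`σ` on secrets, then `m` samples of `A_{s,χ}`. [cite: BrakerskiEtAl2013, Def. 2.11] -/
def lweSamplesSecretLaw (χ : PMF R) (σ : PMF (ι → R)) (m : ℕ) : PMF (Fin m → (ι → R) × R) :=
  σ.bind fun s => lweSamples χ s m

/-- LWE with secret law `σ` and a noise law `χ s` that may depend on the secret (the shape of the
"unknown noise rate `β = β(s) ≤ α`" variant `LWE_{n,q,≤α}`, BLPRS Def. 2.14): `s ← σ`, then `m` samples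
of `A_{s,χ(s)}`. [cite: BrakerskiEtAl2013, Def. 2.14] -/
def lweSamplesSecretNoiseLaw (χ : (ι → R) → PMF R) (σ : PMF (ι → R)) (m : ℕ) :
    PMF (Fin m → (ι → R) × R) :=
  σ.bind fun s => lweSamples (χ s) s m

/-- A constant noise family gives `lweSamplesSecretLaw`. [folklore] -/
theorem lweSamplesSecretNoiseLaw_const (χ : PMF R) (σ : PMF (ι → R)) (m : ℕ) :
    lweSamplesSecretNoiseLaw (fun _ => χ) σ m = lweSamplesSecretLaw χ σ m := rfl

/-- The uniform secret law gives the tree's `lweSamplesUniformSecret` (definitionally).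
[cite: BrakerskiEtAl2013, Def. 2.11] -/
theorem lweSamplesSecretLaw_uniform (χ : PMF R) (m : ℕ) :
    lweSamplesSecretLaw χ (PMF.uniformOfFintype (ι → R)) m = lweSamplesUniformSecret χ m := rfl

/-- The advantage of a distinguisher `D` on `LWE_{m,χ}(σ)`: `|Pr[D(A_{σ,χ}^m)] - Pr[D(U^m)]|`.
[cite: BrakerskiEtAl2013, Def. 2.11] -/
def advantageSecretLaw (χ : PMF R) (σ : PMF (ι → R)) (m : ℕ) (D : Distinguisher ι R m) : ℝ :=
  |(acceptProb D (lweSamplesSecretLaw χ σ m)).toReal - (acceptProb D (uniformSamples ι R m)).toReal|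

/-- The advantage on the secret-dependent-noise variant. [cite: BrakerskiEtAl2013, Def. 2.14] -/
def advantageSecretNoiseLaw (χ : (ι → R) → PMF R) (σ : PMF (ι → R)) (m : ℕ) (D : Distinguisher ι R m) : ℝ :=
  |(acceptProb D (lweSamplesSecretNoiseLaw χ σ m)).toReal - (acceptProb D (uniformSamples ι R m)).toReal|

/-- With the uniform secret law the advantage is the tree's `distinguishingAdvantage` (definitionally).
[cite: BrakerskiEtAl2013, Def. 2.11] -/
theorem advantageSecretLaw_uniform (χ : PMF R) (m : ℕ) (D : Distinguisher ι R m) :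
    advantageSecretLaw χ (PMF.uniformOfFintype (ι → R)) m D = distinguishingAdvantage χ m D := rfl

/-! ### The random self-reduction of the secret -/

/-- **The random self-reduction of Def. 2.11** as a Markov kernel on sample tuples: draw ONE fresh
uniform `t` and shift every sample, `(a, b) ↦ (a, b + ⟨a, t⟩)` (Regev's `f_t`, `shiftSample t`).
[cite: BrakerskiEtAl2013, Def. 2.11 (remark: "using a standard random self-reduction")] -/
def secretShift (m : ℕ) (S : Fin m → (ι → R) × R) : PMF (Fin m → (ι → R) × R) :=
  (PMF.uniformOfFintype (ι → R)).map fun t => shiftSample t ∘ S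

/-- Binding a law of tuples with `secretShift` is shifting by an independent uniform `t`. [folklore] -/
theorem bind_secretShift {m : ℕ} (P : PMF (Fin m → (ι → R) × R)) :
    P.bind (secretShift m) = (PMF.uniformOfFintype (ι → R)).bind fun t => P.map fun S => shiftSample t ∘ S := by
  rw [show P.bind (secretShift m) = P.bind fun S => (PMF.uniformOfFintype (ι → R)).bind fun t =>
      PMF.pure (shiftSample t ∘ S) from rfl, PMF.bind_comm]
  rfl

/-- **`A_{s,χ}^m` goes to `A_{U,χ}^m` for EVERY secret `s`**: shifting by a uniform `t` gives the
samples of the secret `s + t`, which is uniform (`lweSamples_map_shift`, and `t ↦ s + t` is a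
bijection). [cite: BrakerskiEtAl2013, Def. 2.11 (remark)] -/
theorem lweSamples_bind_secretShift (χ : PMF R) (s : ι → R) (m : ℕ) :
    (lweSamples χ s m).bind (secretShift m) = lweSamplesUniformSecret χ m := by
  rw [bind_secretShift]
  simp_rw [lweSamples_map_shift]
  have hbij : Function.Bijective fun t : ι → R => s + t :=
    ⟨fun a b h => add_left_cancel h, fun u => ⟨u - s, add_sub_cancel s u⟩⟩
  rw [lweSamplesUniformSecret]
  conv_rhs => rw [← uniformOfFintype_map_of_bijective hbij, PMF.bind_map]
  rfl

/-- **Secret law `σ`, secret-dependent noise**: after the shift, the secret is a fresh uniform `s'`,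
independent of the hidden `s ← σ` that selects the noise law `χ s`.
[cite: BrakerskiEtAl2013, Def. 2.11 (remark) with Def. 2.14] -/
theorem lweSamplesSecretNoiseLaw_bind_secretShift (χ : (ι → R) → PMF R) (σ : PMF (ι → R)) (m : ℕ) :
    (lweSamplesSecretNoiseLaw χ σ m).bind (secretShift m) =
      σ.bind fun s => lweSamplesUniformSecret (χ s) m := by
  rw [lweSamplesSecretNoiseLaw, PMF.bind_bind]
  exact congrArg _ (funext fun s => lweSamples_bind_secretShift (χ s) s m)

/-- **`LWE(σ)` goes to `LWE(U)`** for every secret law `σ`. [cite: BrakerskiEtAl2013, Def. 2.11 (remark)] -/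
theorem lweSamplesSecretLaw_bind_secretShift (χ : PMF R) (σ : PMF (ι → R)) (m : ℕ) :
    (lweSamplesSecretLaw χ σ m).bind (secretShift m) = lweSamplesUniformSecret χ m := by
  rw [← lweSamplesSecretNoiseLaw_const, lweSamplesSecretNoiseLaw_bind_secretShift]
  exact PMF.bind_const _ _

/-- **`U^m` goes to `U^m`** (each `f_t` preserves the uniform distribution, `uniformSamples_map_shift`).
[cite: BrakerskiEtAl2013, Def. 2.11 (remark)] -/
theorem uniformSamples_bind_secretShift (m : ℕ) :
    (uniformSamples ι R m).bind (secretShift m) = uniformSamples ι R m := by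
  rw [bind_secretShift]
  simp_rw [uniformSamples_map_shift]
  exact PMF.bind_const _ _

/-- The distinguisher `D` precomposed with the random self-reduction. [cite: BrakerskiEtAl2013, Def. 2.11 (remark)] -/
def shiftThen (m : ℕ) (D : Distinguisher ι R m) : Distinguisher ι R m :=
  fun S => (secretShift m S).bind D

/-- Acceptance probability of `shiftThen D` on `P` is that of `D` on `P` shifted. [folklore] -/
theorem acceptProb_shiftThen (m : ℕ) (D : Distinguisher ι R m) (P : PMF (Fin m → (ι → R) × R)) :
    acceptProb (shiftThen m D) P = acceptProb D (P.bind (secretShift m)) := by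
  unfold acceptProb shiftThen
  rw [PMF.bind_bind]

/-- **BLPRS Def. 2.11, the random self-reduction: `LWE_{m,χ}(σ) ≤ LWE_{m,χ}(U)` with NO loss** — for
every secret law `σ` and every distinguisher `D` for the uniform-secret problem,
`Adv_{LWE(σ)}(D ∘ secretShift) = Adv_{LWE(U)}(D)`. [cite: BrakerskiEtAl2013, Def. 2.11 (remark following it)] -/
theorem advantageSecretLaw_secretShift (χ : PMF R) (σ : PMF (ι → R)) (m : ℕ) (D : Distinguisher ι R m) :
    advantageSecretLaw χ σ m (shiftThen m D) = distinguishingAdvantage χ m D := by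
  unfold advantageSecretLaw distinguishingAdvantage
  rw [acceptProb_shiftThen, acceptProb_shiftThen, lweSamplesSecretLaw_bind_secretShift,
    uniformSamples_bind_secretShift]

/-- Secret-dependent noise: the shifted problem is the `σ`-mixture of uniform-secret problems, so the
advantage of `D ∘ secretShift` is that of `D` against the mixture `E_{s←σ} A_{U,χ(s)}^m`.
[cite: BrakerskiEtAl2013, Def. 2.11 (remark) with Def. 2.14] -/
theorem advantageSecretNoiseLaw_secretShift (χ : (ι → R) → PMF R) (σ : PMF (ι → R)) (m : ℕ)
    (D : Distinguisher ι R m) :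
    advantageSecretNoiseLaw χ σ m (shiftThen m D) =
      |(acceptProb D (σ.bind fun s => lweSamplesUniformSecret (χ s) m)).toReal -
        (acceptProb D (uniformSamples ι R m)).toReal| := by
  unfold advantageSecretNoiseLaw
  rw [acceptProb_shiftThen, acceptProb_shiftThen, lweSamplesSecretNoiseLaw_bind_secretShift,
    uniformSamples_bind_secretShift]

end SecretLaw

/-! ### Binary-secret LWE (`binLWE`) -/

section Binary

open LeftoverHash

/-- The uniform law on the binary secrets `{0,1}ⁿ ⊆ ℤ_qⁿ` (the filtered `Finset.univ` of
`LeftoverHashUniversal.lean`, nonempty by `binVecs_nonempty`). [cite: BrakerskiEtAl2013, Def. 2.11 (binLWE)] -/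
def binarySecretLaw (n q : ℕ) [NeZero q] : PMF (Fin n → ZMod q) :=
  PMF.uniformOfFinset (Finset.univ.filter fun z : Fin n → ZMod q => ∀ j, z j = 0 ∨ z j = 1) binVecs_nonempty

variable {n q : ℕ} [NeZero q]

/-- The binary secret law is supported on `{0,1}ⁿ`. [folklore] -/
theorem binarySecretLaw_apply_eq_zero {z : Fin n → ZMod q} (hz : ¬ ∀ j, z j = 0 ∨ z j = 1) :
    binarySecretLaw n q z = 0 := by
  rw [binarySecretLaw, PMF.uniformOfFinset_apply_of_notMem]
  exact fun h => hz ((Finset.mem_filter_univ z).1 h)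

/-- `binLWE_{n,m,q,χ}` (BLPRS Def. 2.11): `m` samples of `A_{z,χ}` for a uniform binary secret `z`.
[cite: BrakerskiEtAl2013, Def. 2.11 (binLWE)] -/
def binLWESamples (χ : PMF (ZMod q)) (m : ℕ) : PMF (Fin m → (Fin n → ZMod q) × ZMod q) :=
  lweSamplesSecretLaw χ (binarySecretLaw n q) m

/-- The advantage of `D` on `binLWE_{n,m,q,χ}`. [cite: BrakerskiEtAl2013, Def. 2.11 (binLWE)] -/
def binLWEAdvantage (χ : PMF (ZMod q)) (m : ℕ) (D : Distinguisher (Fin n) (ZMod q) m) : ℝ :=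
  advantageSecretLaw χ (binarySecretLaw n q) m D

/-- **`binLWE ≤ LWE`** (the random self-reduction at the binary secret law): for every distinguisher
`D` for uniform-secret `LWE_{n,m,q,χ}`, `Adv_{binLWE}(D ∘ secretShift) = Adv_{LWE}(D)`.
[cite: BrakerskiEtAl2013, Def. 2.11 (remark following it)] -/
theorem binLWEAdvantage_secretShift (χ : PMF (ZMod q)) (m : ℕ) (D : Distinguisher (Fin n) (ZMod q) m) :
    binLWEAdvantage χ m (shiftThen m D) = distinguishingAdvantage χ m D :=
  advantageSecretLaw_secretShift χ _ m D

end Binary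

end LWE

end Literature.Computability.Cryptography

end
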